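import Mathlib.Data.Fin.Tuple.Basic
import Mathlib.Logic.Equiv.Fin.Basic
import Literature.InformationTheory.Coding.SourcePolarization
import HarnessLib

/-!
# One step of Arıkan source polarization: the synthetic sources `g⁻`, `g⁺` (definitions)

Topic `Literature/InformationTheory/Coding`.  For a BINARY SOURCE WITH FUNCTIONAL SIDE
INFORMATION `g : ZMod 2 → Ω → β` — the pair `(B, W)` is uniform on `ZMod 2 × Ω`, the source bit is
`B`, the side information is `Y = g B W`; equivalently a binary-input channel `W(y | b)` with UNIFORM
input and transition probabilities `N_b(y) / |Ω|`, `N_b(y) = #{w : g b w = y}` — this file defines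
the data of ONE STEP of Arıkan's polarization [Arıkan 2009, §I.B (channel combining and splitting);
Arıkan 2010, §II–III (source polarization)]:

* `cnt g b y = N_b(y)`, the fibre counts (the unnormalised channel law);
* `condEntG g = H(B | Y) = H((B, Y)) − H(Y)` over the uniform `(B, W)` for a general finite `Ω`
  (`condEnt` of `SourcePolarization.lean` is the case `Ω = Fin m → ZMod 2`, `condEnt_eq_condEntG`);
* `pairEnt a b = a log₂ ((a+b)/a) + b log₂ ((a+b)/b) = (a + b) · h₂(a/(a+b))`, the un-normalised
  binary entropy of a pair of counts, through which `H(B|Y) = (2|Ω|)⁻¹ Σ_y pairEnt (N₀ y) (N₁ y)`;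
* `bhatta g = Z(B | Y) = Σ_y √(W(y|0) W(y|1)) = |Ω|⁻¹ Σ_y √(N₀(y) N₁(y))`, the (source)
  Bhattacharyya parameter [Arıkan 2010, eq. (2): `Z(X|Y) = 2 Σ_y √(P(0,y) P(1,y))`];
* the two synthetic sources of one polarization step on two independent copies
  `(B₁, W₁), (B₂, W₂)`: `gMinus g` — bit `U = B₁ + B₂`, randomness `(B₂, W₁, W₂)`, side information
  `(Y₁, Y₂)`; `gPlus g` — bit `D = B₂`, randomness `(B₁, W₁, W₂)`, side information
  `(B₁ + D, Y₁, Y₂) = (U, Y₁, Y₂)` [Arıkan 2010, §III: `H(U₁ | Y₁Y₂)` and `H(U₂ | Y₁Y₂U₁)`];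
* the packaged form used by the polarization tree: `Src` (a source `g : ZMod 2 → (Fin m → ZMod 2) → β`
  with its `m`, `β`), `Src.minus`, `Src.plus` (the synthetic sources re-encoded on
  `Fin (m + m + 1) → ZMod 2` through the fixed equivalence `unpack m`), `Src.H = condEnt`,
  `Src.zParam = bhatta`;
* the pairings `cfgMinus`, `cfgPlus` reading a configuration of `2^(s+1)` copies of `S` as a
  configuration of `2^s` copies of `S⁻` resp. `S⁺` (copy `c` paired with copy `2^s + c`:
  `loIdx`, `hiIdx`), through which the leakage profile obeys `leak g (s+1) j = leak g⁻ s j`,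
  `leak g (s+1) (2^s + j) = leak g⁺ s j` (proved in the companions).

All statements about these objects (the one-step relations `H⁻ + H⁺ = 2H`, `Z⁺ = Z²`,
`Z√(2 − Z²) ≤ Z⁻ ≤ 2Z − Z²`, `Z² ≤ H ≤ log₂(1 + Z)`, and the identification of the leakage profile
`leak g s j` with the conditional entropies of the leaves of the `(minus, plus)`-tree) are proved in
the theorem-only companions `SourcePolarizationStepProofs*.lean`.

## Design choices

* Uniform input only (the source bit is uniform and independent of the randomness `W`); this class
  is closed under `g ↦ g⁻, g⁺`, which is why the recursion stays inside it.  TODO(general form):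
  arbitrary finite joint laws of `(X, Y)` with `X` binary [Arıkan 2010 allows them].
* `β` need not be finite: all sums over outputs run over the finite image
  `univ.image (fun p => g p.1 p.2)` (or any finite superset — the summands vanish outside).
* The randomness of `Src.minus` / `Src.plus` is indexed by `Fin (m + m + 1)`; only the fact that
  `unpack m` is an equivalence is ever used (entropies and counts are invariant under re-indexing).
* Counts, not probability mass functions: everything is a finite sum of functions of the integers
  `N_b(y)`, in line with `mapEntropy` (the tree's `PMF.bcCoeff` of
  `Literature/Computability/Cryptography/StatisticalDistanceBhattacharyya.lean` is the `PMF`/`tsum`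
  Bhattacharyya coefficient of two laws; `bhatta g` is `bcCoeff` of the two conditional laws
  `W(·|0)`, `W(·|1)`, but we do not import the cryptography library here).
* Not here: channel coding, decoding, non-binary inputs, the polarization theorems themselves.

## References

* E. Arıkan, *Channel polarization: a method for constructing capacity-achieving codes for
  symmetric binary-input memoryless channels*, IEEE Trans. IT 55 (2009), §I.B, Prop. 5.
  bib `Arikan2009`.
* E. Arıkan, *Source polarization*, Proc. IEEE ISIT 2010, 899–903, §II–III, eq. (2), Prop. 2.
  bib `Arikan2010`.
* S. B. Korada, R. Urbanke, *Polar codes are optimal for lossy source coding*, IEEE Trans. IT 56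
  (2010), Lemma 17 (lower bound on `Z⁻`).  bib `KoradaUrbanke2010`.
-/

noncomputable section

namespace Literature.InformationTheory.Coding.Polar

open Finset Literature.InformationTheory.Entropy

variable {Ω : Type*} [Fintype Ω] {β : Type*} [DecidableEq β]

/-! ### Counts, conditional entropy and Bhattacharyya parameter of a source over a finite `Ω` -/

/-- The fibre count `N_b(y) = #{w ∈ Ω : g b w = y}`: `|Ω|` times the channel law `W(y | b)` of the
uniform-input binary channel `B ↦ Y = g B W`. [cite: Arikan2009, §I.A (transition probabilities W(y|x))] -/
def cnt (g : ZMod 2 → Ω → β) (b : ZMod 2) (y : β) : ℕ :=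
  (univ.filter fun w => g b w = y).card

/-- The conditional entropy `H(B | Y) = H((B, Y)) − H(Y)` (bits) of the source bit given the side
information `Y = g B W`, over the uniform `(B, W) ∈ ZMod 2 × Ω`, for a general finite `Ω`
(`condEnt` is the case `Ω = Fin m → ZMod 2`). [cite: CoverThomas2006, Thm 2.2.1 (H(X,Y) = H(Y) + H(X|Y))] -/
def condEntG (g : ZMod 2 → Ω → β) : ℝ :=
  mapEntropy univ (fun p : ZMod 2 × Ω => (p.1, g p.1 p.2)) -
    mapEntropy univ (fun p : ZMod 2 × Ω => g p.1 p.2)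

/-- The un-normalised binary entropy of a pair of counts,
`pairEnt a b = a log₂ ((a+b)/a) + b log₂ ((a+b)/b) = (a + b) h₂(a / (a + b))` (bits; the junk
conventions `x / 0 = 0`, `log₂ 0 = 0` make every term with a zero count vanish). [folklore] -/
def pairEnt (a b : ℝ) : ℝ :=
  a * Real.logb 2 ((a + b) / a) + b * Real.logb 2 ((a + b) / b)

/-- The (source) Bhattacharyya parameter `Z(B | Y) = 2 Σ_y √(P(0,y) P(1,y)) = Σ_y √(W(y|0) W(y|1))
= |Ω|⁻¹ Σ_y √(N₀(y) N₁(y))`, summed over the (finite) set of outputs that occur.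
[cite: Arikan2010, eq. (2) (source Bhattacharyya parameter)] -/
def bhatta (g : ZMod 2 → Ω → β) : ℝ :=
  (∑ y ∈ univ.image (fun p : ZMod 2 × Ω => g p.1 p.2), Real.sqrt (cnt g 0 y * cnt g 1 y)) /
    Fintype.card Ω

/-! ### The two synthetic sources of one polarization step -/

/-- Arıkan's MINUS transform of a source on two independent copies `(B₁, W₁), (B₂, W₂)`: the bit is
`U = B₁ + B₂`, the randomness is `(B₂, W₁, W₂)` (uniform, independent of `U`), the side information
is `(Y₁, Y₂) = (g (U + B₂) W₁, g B₂ W₂)`.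
[cite: Arikan2010, §III (U₁ = X₁ + X₂ observed through Y₁ Y₂)] -/
def gMinus (g : ZMod 2 → Ω → β) : ZMod 2 → ZMod 2 × Ω × Ω → β × β :=
  fun u q => (g (u + q.1) q.2.1, g q.1 q.2.2)

/-- Arıkan's PLUS transform of a source on two independent copies: the bit is `D = B₂`, the
randomness is `(B₁, W₁, W₂)`, the side information is `(B₁ + D, Y₁, Y₂) = (U, Y₁, Y₂)`.
[cite: Arikan2010, §III (U₂ = X₂ observed through Y₁ Y₂ U₁)] -/
def gPlus (g : ZMod 2 → Ω → β) : ZMod 2 → ZMod 2 × Ω × Ω → ZMod 2 × β × β :=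
  fun d q => (q.1 + d, g q.1 q.2.1, g d q.2.2)

/-- The fixed re-indexing `F₂^{m+m+1} ≃ F₂ × F₂^m × F₂^m` (head bit, then the two halves) used to
present the synthetic sources again with randomness `Fin m' → ZMod 2`. [folklore] -/
def unpack (m : ℕ) : (Fin (m + m + 1) → ZMod 2) ≃ ZMod 2 × (Fin m → ZMod 2) × (Fin m → ZMod 2) :=
  (Fin.consEquiv fun _ : Fin (m + m + 1) => ZMod 2).symm.trans
    (Equiv.prodCongr (Equiv.refl (ZMod 2))
      ((finSumFinEquiv.arrowCongr (Equiv.refl (ZMod 2))).symm.trans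
        (Equiv.sumArrowEquivProdArrow (Fin m) (Fin m) (ZMod 2))))

/-! ### Packaged sources -/

/-- A binary source with functional side information, packaged: `m` random bits `W ∈ F₂^m` besides
the uniform source bit `B`, an output type `β` with decidable equality, and the side-information
map `g` (`Y = g B W`).  Lives in `Type 1`. [cite: Arikan2010, §II (memoryless source (X,Y), X binary)] -/
structure Src where
  /-- number of random bits besides the source bit -/
  m : ℕ
  /-- type of the side information -/
  β : Type
  /-- decidable equality of outputs (needed to count fibres) -/
  [decEq : DecidableEq β]
  /-- the side-information map `Y = g B W` -/
  g : ZMod 2 → (Fin m → ZMod 2) → β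

attribute [instance] Src.decEq

/-- The MINUS transform of a packaged source: `gMinus` re-indexed on `Fin (m + m + 1) → ZMod 2`
through `unpack m`; outputs `β × β`. [cite: Arikan2010, §III (U₁ = X₁ + X₂ observed through Y₁ Y₂)] -/
def Src.minus (S : Src) : Src where
  m := S.m + S.m + 1
  β := S.β × S.β
  g := fun u w => gMinus S.g u (unpack S.m w)

/-- The PLUS transform of a packaged source: `gPlus` re-indexed on `Fin (m + m + 1) → ZMod 2`
through `unpack m`; outputs `ZMod 2 × β × β`. [cite: Arikan2010, §III (U₂ = X₂ observed through Y₁ Y₂ U₁)] -/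
def Src.plus (S : Src) : Src where
  m := S.m + S.m + 1
  β := ZMod 2 × S.β × S.β
  g := fun d w => gPlus S.g d (unpack S.m w)

/-- The Bhattacharyya parameter `Z(B | Y) = 2^{-m} Σ_y √(N₀(y) N₁(y))` of a packaged source.
[cite: Arikan2010, eq. (2) (source Bhattacharyya parameter)] -/
def Src.zParam (S : Src) : ℝ :=
  bhatta S.g

/-- The conditional entropy `H(B | Y)` (bits) of a packaged source (`condEnt` of its map).
[cite: Arikan2010, §II (H(X|Y))] -/
def Src.H (S : Src) : ℝ :=
  condEnt S.g

/-! ### Pairing the copies: level `s + 1` configurations as level `s` configurations of `S⁻`, `S⁺` -/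

/-- `2^(s+1) = 2^s + 2^s`. [folklore] -/
theorem two_pow_succ_eq (s : ℕ) : 2 ^ (s + 1) = 2 ^ s + 2 ^ s := by
  rw [pow_succ]
  ring

/-- The LOW copy of pair `c`: index `c` of `Fin (2^(s+1))`. [folklore] -/
def loIdx (s : ℕ) (c : Fin (2 ^ s)) : Fin (2 ^ (s + 1)) :=
  ⟨c, by rw [two_pow_succ_eq]; omega⟩

/-- The HIGH copy of pair `c`: index `2^s + c` of `Fin (2^(s+1))`. [folklore] -/
def hiIdx (s : ℕ) (c : Fin (2 ^ s)) : Fin (2 ^ (s + 1)) :=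
  ⟨2 ^ s + c, by rw [two_pow_succ_eq]; omega⟩

/-- **Pairing for the minus step.**  A configuration of `2^(s+1)` copies of `S` is read as a
configuration of `2^s` copies of `S⁻`: pair copy `c` with copy `2^s + c`; the new source bit is
`U_c = B_c + B_{2^s+c}` and the new randomness is `(B_{2^s+c}, W_c, W_{2^s+c})` (re-indexed by
`unpack`).  With the natural-order polar transform, `U^{(s+1)}_j = U^{(s)}_j(U)` for `j < 2^s`.
[cite: Arikan2009, §VII (recursive structure of G_N, eq. (70)–(72))] -/
def cfgMinus {m : ℕ} (s : ℕ) (X : Cfg (s + 1) m) : Cfg s (m + m + 1) := fun c =>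
  ((X (loIdx s c)).1 + (X (hiIdx s c)).1,
    (unpack m).symm ((X (hiIdx s c)).1, (X (loIdx s c)).2, (X (hiIdx s c)).2))

/-- **Pairing for the plus step.**  A configuration of `2^(s+1)` copies of `S` is read as a
configuration of `2^s` copies of `S⁺`: the new source bit is `D_c = B_{2^s+c}` and the new
randomness is `(B_c, W_c, W_{2^s+c})`.  With the natural-order polar transform,
`U^{(s+1)}_{2^s + j} = U^{(s)}_j(D)`. [cite: Arikan2009, §VII (recursive structure of G_N, eq. (70)–(72))] -/
def cfgPlus {m : ℕ} (s : ℕ) (X : Cfg (s + 1) m) : Cfg s (m + m + 1) := fun c =>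
  ((X (hiIdx s c)).1, (unpack m).symm ((X (loIdx s c)).1, (X (loIdx s c)).2, (X (hiIdx s c)).2))

/-! ### Unfolding lemmas -/

/-- Value of the low index. [folklore] -/
@[simp] theorem loIdx_val (s : ℕ) (c : Fin (2 ^ s)) : (loIdx s c).val = c :=
  rfl

/-- Value of the high index. [folklore] -/
@[simp] theorem hiIdx_val (s : ℕ) (c : Fin (2 ^ s)) : (hiIdx s c).val = 2 ^ s + c :=
  rfl

/-- `cfgMinus` applied. [folklore] -/
@[simp] theorem cfgMinus_apply {m : ℕ} (s : ℕ) (X : Cfg (s + 1) m) (c : Fin (2 ^ s)) :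
    cfgMinus s X c = ((X (loIdx s c)).1 + (X (hiIdx s c)).1,
      (unpack m).symm ((X (hiIdx s c)).1, (X (loIdx s c)).2, (X (hiIdx s c)).2)) :=
  rfl

/-- `cfgPlus` applied. [folklore] -/
@[simp] theorem cfgPlus_apply {m : ℕ} (s : ℕ) (X : Cfg (s + 1) m) (c : Fin (2 ^ s)) :
    cfgPlus s X c =
      ((X (hiIdx s c)).1, (unpack m).symm ((X (loIdx s c)).1, (X (loIdx s c)).2, (X (hiIdx s c)).2)) :=
  rfl


omit [Fintype Ω] [DecidableEq β] in
/-- `gMinus` unfolded. [folklore] -/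
@[simp] theorem gMinus_apply (g : ZMod 2 → Ω → β) (u : ZMod 2) (q : ZMod 2 × Ω × Ω) :
    gMinus g u q = (g (u + q.1) q.2.1, g q.1 q.2.2) :=
  rfl

omit [Fintype Ω] [DecidableEq β] in
/-- `gPlus` unfolded. [folklore] -/
@[simp] theorem gPlus_apply (g : ZMod 2 → Ω → β) (d : ZMod 2) (q : ZMod 2 × Ω × Ω) :
    gPlus g d q = (q.1 + d, g q.1 q.2.1, g d q.2.2) :=
  rfl

/-- The number of random bits of `S.minus`. [folklore] -/
@[simp] theorem Src.minus_m (S : Src) : S.minus.m = S.m + S.m + 1 :=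
  rfl

/-- The number of random bits of `S.plus`. [folklore] -/
@[simp] theorem Src.plus_m (S : Src) : S.plus.m = S.m + S.m + 1 :=
  rfl

/-- The map of `S.minus` is `gMinus S.g` re-indexed through `unpack`. [folklore] -/
theorem Src.minus_g (S : Src) :
    S.minus.g = fun u (w : Fin (S.m + S.m + 1) → ZMod 2) => gMinus S.g u (unpack S.m w) :=
  rfl

/-- The map of `S.plus` is `gPlus S.g` re-indexed through `unpack`. [folklore] -/
theorem Src.plus_g (S : Src) :
    S.plus.g = fun d (w : Fin (S.m + S.m + 1) → ZMod 2) => gPlus S.g d (unpack S.m w) :=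
  rfl

/-- `S.minus.g` applied. [folklore] -/
@[simp] theorem Src.minus_g_apply (S : Src) (u : ZMod 2) (w : Fin (S.m + S.m + 1) → ZMod 2) :
    S.minus.g u w = (S.g (u + (unpack S.m w).1) (unpack S.m w).2.1,
      S.g (unpack S.m w).1 (unpack S.m w).2.2) :=
  rfl

/-- `S.plus.g` applied. [folklore] -/
@[simp] theorem Src.plus_g_apply (S : Src) (d : ZMod 2) (w : Fin (S.m + S.m + 1) → ZMod 2) :
    S.plus.g d w = ((unpack S.m w).1 + d, S.g (unpack S.m w).1 (unpack S.m w).2.1,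
      S.g d (unpack S.m w).2.2) :=
  rfl

/-- `Src.H` unfolded. [folklore] -/
theorem Src.H_def (S : Src) : S.H = condEnt S.g :=
  rfl

/-- `Src.zParam` unfolded. [folklore] -/
theorem Src.zParam_def (S : Src) : S.zParam = bhatta S.g :=
  rfl

/-- `condEnt` is `condEntG` for `Ω = Fin m → ZMod 2`. [folklore] -/
theorem condEnt_eq_condEntG {m : ℕ} {β : Type} [DecidableEq β]
    (g : ZMod 2 → (Fin m → ZMod 2) → β) : condEnt g = condEntG g :=
  rfl

/-- Round trip through a packaged source. [folklore] -/
@[simp] theorem Src.mk_g {m : ℕ} {β : Type} [DecidableEq β] (g : ZMod 2 → (Fin m → ZMod 2) → β) :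
    (Src.mk m β g).g = g :=
  rfl

end Literature.InformationTheory.Coding.Polar

end
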